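import Mathlib
import HarnessLib
import Summits.ResolutionOfSingularities.ResolutionOfSingularities.Theorems.HomologicalConductorNoZenoOrdValuation

/-!
# Route `HomologicalConductor`, crux `NoZeno`/`NoZenoR` (stmt-ResolutionOfSingularities-16483 / -19943),
# line `sandwich-cluster`: the order valuation ring of a regular local `S` is a DVR

OURS (cell res-hironaka, crux chain W4.4, seat res-L0-w44-stub-3). Nothing here is a statement of the
manuscript under review (Hironaka 2017); AI-written, weaker than expert review.

Companion of `HomologicalConductorNoZenoOrdValuation.lean` (`ordSet S` is a valuation subring `V` of `K`
for `S` regular local with `Frac S = K`).  Here: for `S` not a field, `V` is a DISCRETE VALUATION RING —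
the prime divisor `E_q` of the line's dictionary (CRUX-PLAN W4.4 v2 §2) is a discrete rank-one valuation
(Zariski–Samuel II, Ch. VIII §1, Corollary to Thm. 1):

* `exists_mem_maximalIdeal_not_mem_sq` — a Noetherian local ring that is not a field has an element of
  order exactly one (`𝔪 ≠ 𝔪²`, Nakayama);
* `isUnit_iff_inv_mem` — `0 ≠ w ∈ V` is a unit of `V` iff `w⁻¹ ∈ V`;
* **`isDiscreteValuationRing_of_coe_eq_ordSet`** — `↑V = ordSet S`, `𝔪_S ≠ 0` ⇒
  `IsDiscreteValuationRing ↥V`: the image `τ` of any `t ∈ 𝔪_S ∖ 𝔪_S²` is irreducible in `V` and every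
  non-zero `x = a/b ∈ V` is a unit times `τ ^ (ord a − ord b)`
  (`IsDiscreteValuationRing.ofHasUnitMulPowIrreducibleFactorization`).

Not here: the residue field of `V` (purely transcendental of degree `dim S − 1` over `S/𝔪_S`).

References: O. Zariski, P. Samuel, *Commutative Algebra* II (1960), Ch. VIII §1, Thm. 1 and Corollary
[`ZariskiSamuel1960`].
-/

noncomputable section

-- single-problem summit: the doubled namespace component `ResolutionOfSingularities` is forced
set_option linter.dupNamespace false

namespace Summit.ResolutionOfSingularities.ResolutionOfSingularities.Theorems.NoZeno.SandwichCluster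

open IsLocalRing Literature.AlgebraicGeometry.Resolution

variable {k K : Type} [Field k] [Field K] [Algebra k K]

section DVR

variable {S : Subalgebra k K} [IsRegularLocalRing ↥S]

/-- In a Noetherian local ring that is not a field there is an element of order exactly one
(`𝔪 ≠ 𝔪²` by Nakayama). [folklore] -/
theorem exists_mem_maximalIdeal_not_mem_sq (h : maximalIdeal ↥S ≠ ⊥) :
    ∃ t : ↥S, t ∈ maximalIdeal ↥S ∧ t ∉ maximalIdeal ↥S ^ 2 := by
  by_contra hcon
  have hcon' : ∀ t : ↥S, t ∈ maximalIdeal ↥S → t ∈ maximalIdeal ↥S ^ 2 :=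
    fun t ht => by_contra fun h2 => hcon ⟨t, ht, h2⟩
  apply h
  refine Submodule.eq_bot_of_le_smul_of_le_jacobson_bot (maximalIdeal ↥S) (maximalIdeal ↥S)
    (IsNoetherian.noetherian _) ?_ (IsLocalRing.maximalIdeal_le_jacobson _)
  intro t ht
  have := hcon' t ht
  rwa [pow_two, ← Ideal.smul_eq_mul] at this

/-- A unit criterion in the order valuation ring: `w ∈ V`, `w ≠ 0` is a unit iff `w⁻¹ ∈ V`. [folklore] -/
theorem isUnit_iff_inv_mem (V : ValuationSubring K) (w : ↥V) (hw : (w : K) ≠ 0) :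
    IsUnit w ↔ ((w : K))⁻¹ ∈ V := by
  rw [ValuationSubring.valuation_eq_one_iff]
  have hle := V.valuation_le_one w
  have hv0 : 0 < V.valuation (w : K) := (Valuation.pos_iff _).mpr hw
  rw [← ValuationSubring.valuation_le_one_iff, map_inv₀, inv_le_one₀ hv0]
  exact ⟨fun h => h.symm.le, fun h => le_antisymm hle h⟩

/-- **The order valuation ring is a discrete valuation ring** (regular local `S`, not a field): every
non-zero element of `V` is a unit times a power of (the image of) any `t ∈ 𝔪_S ∖ 𝔪_S²`, which is
irreducible in `V`; so `V` is a DVR — the prime divisor `E_q` is a discrete rank-one valuation.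
[cite: ZariskiSamuel1960, Ch. VIII §1 Thm. 1 and Corollary] -/
theorem isDiscreteValuationRing_of_coe_eq_ordSet (V : ValuationSubring K) (hV : (V : Set K) = ordSet S)
    (h𝔪 : maximalIdeal ↥S ≠ ⊥) : IsDiscreteValuationRing ↥V := by
  haveI := isDomain_of_isRegularLocalRing (↥S)
  obtain ⟨t, ht𝔪, ht2⟩ := exists_mem_maximalIdeal_not_mem_sq h𝔪
  have ht0 : t ≠ 0 := by rintro rfl; exact ht2 (zero_mem _)
  have htK : (t : K) ≠ 0 := fun h => ht0 (by exact_mod_cast h)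
  have hordt : adicOrder t = 1 := by
    refine le_antisymm ?_ ?_
    · have := (adicOrder_le_iff t 1).mpr ht2
      exact_mod_cast this
    · have := (le_adicOrder_iff t 1).mpr (by rwa [pow_one])
      exact_mod_cast this
  have memV : ∀ {x : K}, x ∈ V ↔ x ∈ ordSet S := fun {x} => by
    rw [← SetLike.mem_coe, hV]
  have htV : (t : K) ∈ V := memV.mpr (coe_mem_ordSet S t)
  -- every `a * b⁻¹` with `ord b + n = ord a` is `unit * t ^ n`
  have key : ∀ (a b : ↥S), a ≠ 0 → b ≠ 0 → ∀ n : ℕ, adicOrder a = adicOrder b + n →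
      ((a : K) * ((b : K))⁻¹) * ((t : K) ^ n)⁻¹ ∈ V ∧
        (((a : K) * ((b : K))⁻¹) * ((t : K) ^ n)⁻¹)⁻¹ ∈ V := by
    intro a b ha hb n hn
    have hbt : b * t ^ n ≠ 0 := mul_ne_zero hb (pow_ne_zero _ ht0)
    have hord : adicOrder (b * t ^ n) = adicOrder a := by
      rw [adicOrder_mul, adicOrder_pow, hordt, mul_one, hn]
    have e1 : ((a : K) * ((b : K))⁻¹) * ((t : K) ^ n)⁻¹ = (a : K) * (((b * t ^ n : ↥S) : K))⁻¹ := by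
      push_cast; rw [mul_inv]; ring
    have e2 : (((a : K) * ((b : K))⁻¹) * ((t : K) ^ n)⁻¹)⁻¹ = ((b * t ^ n : ↥S) : K) * ((a : K))⁻¹ := by
      rw [e1, mul_inv, inv_inv, mul_comm]
    rw [e2, e1, memV, memV, coe_mul_inv_mem_ordSet_iff S _ _ hbt, coe_mul_inv_mem_ordSet_iff S _ _ ha,
      hord]
    exact ⟨le_rfl, le_rfl⟩
  let τ : ↥V := ⟨(t : K), htV⟩
  have hτK : ((τ : ↥V) : K) = (t : K) := rfl
  -- `τ` is not a unit
  have hτnu : ¬ IsUnit τ := by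
    rw [isUnit_iff_inv_mem V τ (by rw [hτK]; exact htK), hτK, memV, inv_coe_mem_ordSet_iff S t ht0]
    exact fun h => h ht𝔪
  -- orders of numerator/denominator of an element of `V`
  have decomp : ∀ x : ↥V, x ≠ 0 → ∃ n : ℕ, ∃ u : (↥V)ˣ, (τ ^ n * u : ↥V) = x := by
    intro x hx
    have hxK : (x : K) ≠ 0 := fun h => hx (by exact_mod_cast h)
    obtain ⟨a, b, hb, hle, hxe⟩ := (mem_ordSet_iff S).mp (memV.mp x.property)
    have ha : a ≠ 0 := by
      rintro rfl; apply hxK; rw [hxe]; simp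
    obtain ⟨p, hp⟩ := ENat.ne_top_iff_exists.mp (adicOrder_ne_top ha)
    obtain ⟨q, hq⟩ := ENat.ne_top_iff_exists.mp (adicOrder_ne_top hb)
    have hqp : q ≤ p := by rw [← hp, ← hq] at hle; exact_mod_cast hle
    refine ⟨p - q, ?_⟩
    have hn : adicOrder a = adicOrder b + ((p - q : ℕ) : ℕ∞) := by
      rw [← hp, ← hq]; norm_cast; omega
    obtain ⟨hu, hu'⟩ := key a b ha hb (p - q) hn
    have hune : ((a : K) * ((b : K))⁻¹) * ((t : K) ^ (p - q))⁻¹ ≠ 0 := by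
      have hbK : (b : K) ≠ 0 := fun h => hb (by exact_mod_cast h)
      have haK : (a : K) ≠ 0 := fun h => ha (by exact_mod_cast h)
      exact mul_ne_zero (mul_ne_zero haK (inv_ne_zero hbK)) (inv_ne_zero (pow_ne_zero _ htK))
    let uV : ↥V := ⟨_, hu⟩
    have huunit : IsUnit uV := (isUnit_iff_inv_mem V uV hune).mpr hu'
    refine ⟨huunit.unit, ?_⟩
    apply Subtype.ext
    rw [hxe]
    show ((τ : ↥V) : K) ^ (p - q) * (((a : K) * ((b : K))⁻¹) * ((t : K) ^ (p - q))⁻¹) = _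
    rw [hτK]
    field_simp
  -- irreducibility of `τ`
  have hirr : Irreducible τ := by
    refine ⟨hτnu, ?_⟩
    intro y z hyz
    by_contra hcon
    have hy : ¬ IsUnit y := fun h' => hcon (Or.inl h')
    have hz : ¬ IsUnit z := fun h' => hcon (Or.inr h')
    have hy0 : y ≠ 0 := by rintro rfl; apply htK; rw [← hτK, hyz]; simp
    have hz0 : z ≠ 0 := by rintro rfl; apply htK; rw [← hτK, hyz]; simp
    -- non-units of `V` are divisible by `τ`
    have hdiv : ∀ w : ↥V, w ≠ 0 → ¬ IsUnit w → ∃ w' : ↥V, w = τ * w' := by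
      intro w hw hwu
      obtain ⟨n, u, hwu'⟩ := decomp w hw
      rcases Nat.eq_zero_or_pos n with hn | hn
      · exfalso; apply hwu; rw [← hwu', hn, pow_zero, one_mul]; exact Units.isUnit u
      · refine ⟨τ ^ (n - 1) * u, ?_⟩
        rw [← hwu', ← mul_assoc, ← pow_succ', Nat.sub_add_cancel hn]
    obtain ⟨y', hy'⟩ := hdiv y hy0 hy
    obtain ⟨z', hz'⟩ := hdiv z hz0 hz
    apply hτnu
    have hτ0 : (τ : ↥V) ≠ 0 := fun h => htK (by rw [← hτK, h]; rfl)
    have : τ * (τ * (y' * z')) = τ * 1 := by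
      rw [mul_one]
      calc τ * (τ * (y' * z')) = (τ * y') * (τ * z') := by ring
        _ = y * z := by rw [hy', hz']
        _ = τ := hyz.symm
    have h1 : τ * (y' * z') = 1 := mul_left_cancel₀ hτ0 this
    exact IsUnit.of_mul_eq_one (y' * z') h1
  exact IsDiscreteValuationRing.ofHasUnitMulPowIrreducibleFactorization
    ⟨τ, hirr, fun {x} hx => by
      obtain ⟨n, u, hu⟩ := decomp x hx
      exact ⟨n, u, hu⟩⟩

end DVR

end Summit.ResolutionOfSingularities.ResolutionOfSingularities.Theorems.NoZeno.SandwichCluster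

end
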